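import Summits.ValiantsHypothesis.ValiantsHypothesis.Theorems.KPlusLogSqLawTropicalBSeparatedLex
import Summits.ValiantsHypothesis.ValiantsHypothesis.Theorems.KPlusLogSqLawTropicalBMatchingNesting
import Summits.ValiantsHypothesis.ValiantsHypothesis.Theorems.KPlusLogSqLawTropicalBMatchingTies

/-!
# Route «KPlusLogSqLaw», crux `TropicalB` (stmt-ValiantsHypothesis-19771) — SEPARATED SCALES KILL THE SECOND DIGIT:
# a pure lexicographic three-class design with a dense bottom class has at most `4m` terms in any dominant chain of its window

HONEST FRAMING.  Helper toward the registered stubs `stub_tropThin` / `stub_tropFat` of `Cruxes/TropicalB/Lines/birth.lean`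
(crux `Summit.ValiantsHypothesis.ValiantsHypothesis.Theses.KPlusLogSqLaw.TropicalB`, item stmt-ValiantsHypothesis-19771, route
KPlusLogSqLaw; cell `pub-symmetroid`, seat val-sym-trop-p1 g8, 2026-08-27; `--supports … --as helper`).  A SECTOR theorem for the
format of SHIFT-THREE (three slope classes); nothing here bounds `TropicalB` for general designs or bears on `WeakLifting`,
DoorA26 / DoorA34, `MatrixDescartes` (stmt-ValiantsHypothesis-18050) or VP ≠ VNP.

THE THEOREM (`chain_le_four_mul`).  Let a design of format `(m, K)` use three classes only — bottom `z` (`d z = 0`, valuations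
`|v| ≤ A`, PRESENT ON EVERY ENTRY), middle `w` and top `h` (`d w < d h`, valuations `v = d·u` with digits `|u| ≤ A`) — with
injective, super-separated exponents (`8m²(A+1)·d j ≤ d j'` for `d j < d j'`, `8m²(A+1) ≤ d j` for `j ≠ z`) and generic digits in the
classes `w`, `h` (distinct equal-size sets of present cells have distinct digit sums).  Then every chain of terms dominant at strictly
increasing integer slopes inside the lexicographic window `|θ| ≤ (2m+1)A + 1`, with consecutive terms distinct, has

  `n ≤ 4·m`.

Slope counting allows `(m+1)(m+2)/2 − 1` here and SHIFT-THREE (unseparated: `d = (0, 1, m(2m+3))` with penalties on all classes)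
realises `(m+1)(m+2)/2 − 2`; so in this format the second multiplying digit NEEDS coupled scales (or a sparse bottom class).

PROOF (memo SEPARATED-LEVELS-g8.md §2, K = 3).  By `SeparatedLex.level_min_of_isDominant` the top cells `R_k` of the `k`-th term
minimise `Σ u_h − θ_k·|·|` over all matchings of present top cells, and the middle cells `S_k` minimise `Σ u_w − θ_k·|·|` over the
matchings of present middle cells avoiding the rows and columns of `R_k`.  Along the chain `|R_k|` is non-decreasing and its coverage
nested (`MatchingExchange.card_mono_of_param`, `cover_mono_of_param`), so the middle level's allowed set only loses vertices — exactly
`2(|R_{k+1}| − |R_k|)` of them — and by the tie-tolerant deletion stability (`exists_isMin_card_le_rows/cols`) with the monotone statics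
`|S_k| ≤ |S_{k+1}| + 2(|R_{k+1}| − |R_k|)`; if `|R|` does not move then `R` does not move, and then `|S|` does not drop and moves unless
`S` is unchanged; and `R`, `S` both unchanged is impossible for two distinct mutually dominated terms (their class maps coincide, so
their weights differ by a slope-free constant).  Hence the potential `3|R_k| + |S_k| ≤ 4m` increases at every step.
-/

set_option linter.dupNamespace false
set_option autoImplicit false

namespace Summit.ValiantsHypothesis.ValiantsHypothesis.Theorems.KPlusLogSqLaw

namespace SeparatedLex

open Summit.ValiantsHypothesis.ValiantsHypothesis.Theorems.MatrixDescartes.Negative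
open Finset
open scoped BigOperators
open Literature.Computability.MetaComplexity.PBij
open MatchingExchange

variable {m K : ℕ}

/-- `Σ_{e∈M} (f e − θ) = Σ_{e∈M} f e − θ·|M|`. [folklore] -/
theorem sum_sub_const (M : Finset (Fin m × Fin m)) (f : Fin m × Fin m → ℤ) (θ : ℤ) :
    ∑ e ∈ M, (f e - θ) = ∑ e ∈ M, f e - θ * (M.card : ℤ) := by
  rw [Finset.sum_sub_distrib, Finset.sum_const, nsmul_eq_mul]; ring

/-- a matching of cells of `Fin m × Fin m` has at most `m` edges. [folklore] -/
theorem card_le_of_isPMatching {M : Finset (Fin m × Fin m)} (hM : IsPMatching M) : M.card ≤ m := by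
  rw [← hM.card_dom]
  exact (Finset.card_le_univ _).trans (by simp)

/-- **SEPARATED SCALES KILL THE SECOND DIGIT.**  See the module docstring: in a pure lexicographic three-class design (`z` dense
bottom, `w` middle, `h` top; super-separated injective exponents; generic digits in `w`, `h`), a chain of distinct consecutive terms
dominant at strictly increasing integer slopes of the window `|θ| ≤ (2m+1)A + 1` has `n ≤ 4m`. -/
theorem chain_le_four_mul (d : Fin K → ℕ) (v ε : Fin m → Fin m → Fin K → ℤ) (u : Fin m → Fin m → Fin K → ℤ)
    (A : ℕ) (z w h : Fin K) (hwz : w ≠ z) (hhz : h ≠ z) (hdz : d z = 0) (hwh : d w < d h)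
    (hinj : Function.Injective d)
    (hcls : ∀ a b j, ε a b j ≠ 0 → j = z ∨ j = w ∨ j = h)
    (hu : ∀ a b j, j ≠ z → v a b j = (d j : ℤ) * u a b j) (huA : ∀ a b j, |u a b j| ≤ A) (hvz : ∀ a b, |v a b z| ≤ A)
    (hdense : ∀ a b, ε a b z ≠ 0)
    (hsep : ∀ j j', d j < d j' → 8 * m ^ 2 * (A + 1) * d j ≤ d j') (hsep0 : ∀ j, j ≠ z → 8 * m ^ 2 * (A + 1) ≤ d j)
    (hgenh : ∀ X Y : Finset (Fin m × Fin m), IsPMatching X → IsPMatching Y → (∀ e ∈ X, ε e.1 e.2 h ≠ 0) →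
      (∀ e ∈ Y, ε e.1 e.2 h ≠ 0) → X.card = Y.card → ∑ e ∈ X, u e.1 e.2 h = ∑ e ∈ Y, u e.1 e.2 h → X = Y)
    (hgenw : ∀ X Y : Finset (Fin m × Fin m), IsPMatching X → IsPMatching Y → (∀ e ∈ X, ε e.1 e.2 w ≠ 0) →
      (∀ e ∈ Y, ε e.1 e.2 w ≠ 0) → X.card = Y.card → ∑ e ∈ X, u e.1 e.2 w = ∑ e ∈ Y, u e.1 e.2 w → X = Y)
    {n : ℕ} (θ : Fin (n + 1) → ℤ) (p : Fin (n + 1) → Equiv.Perm (Fin m) × (Fin m → Fin K))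
    (hθ : StrictMono θ) (hwin : ∀ k, |θ k| ≤ (2 * m + 1) * A + 1) (hdom : ∀ k, IsDominant d v ε (θ k) (p k))
    (hne : ∀ k : Fin n, p k.castSucc ≠ p k.succ) :
    n ≤ 4 * m := by
  classical
  -- present classes are `z`, `w`, `h`
  have hpres : ∀ k b, (p k).2 b = z ∨ (p k).2 b = w ∨ (p k).2 b = h := fun k b =>
    hcls _ _ _ ((termSign_ne_zero_iff ε (p k)).1 (hdom k).1 b)
  have hnot_gt_h : ∀ k b, ¬ d h < d ((p k).2 b) := by
    intro k b hlt
    rcases hpres k b with e | e | e <;> rw [e] at hlt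
    · rw [hdz] at hlt; exact Nat.not_lt_zero _ hlt
    · exact lt_asymm hwh hlt
    · exact lt_irrefl _ hlt
  have hgt_w : ∀ k b, d w < d ((p k).2 b) → (p k).2 b = h := by
    intro k b hlt
    rcases hpres k b with e | e | e
    · rw [e, hdz] at hlt; exact absurd hlt (Nat.not_lt_zero _)
    · rw [e] at hlt; exact absurd hlt (lt_irrefl _)
    · exact e
  -- the top cells `R k` and middle cells `S k`
  let R : Fin (n + 1) → Finset (Fin m × Fin m) := fun k =>
    (Finset.univ.filter fun b : Fin m => (p k).2 b = h).image fun b => ((p k).1 b, b)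
  let S : Fin (n + 1) → Finset (Fin m × Fin m) := fun k =>
    (Finset.univ.filter fun b : Fin m => (p k).2 b = w).image fun b => ((p k).1 b, b)
  have hRdef : ∀ k, R k = (Finset.univ.filter fun b : Fin m => (p k).2 b = h).image fun b => ((p k).1 b, b) := fun k => rfl
  have hSdef : ∀ k, S k = (Finset.univ.filter fun b : Fin m => (p k).2 b = w).image fun b => ((p k).1 b, b) := fun k => rfl
  have hRm : ∀ k, IsPMatching (R k) := fun k => isPMatching_cells (p k) h
  have hSm : ∀ k, IsPMatching (S k) := fun k => isPMatching_cells (p k) w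
  have hmemR : ∀ k e, e ∈ R k ↔ e.1 = (p k).1 e.2 ∧ (p k).2 e.2 = h := fun k e => mem_cells
  have hmemS : ∀ k e, e ∈ S k ↔ e.1 = (p k).1 e.2 ∧ (p k).2 e.2 = w := fun k e => mem_cells
  -- allowed edge sets
  let Gh : Finset (Fin m × Fin m) := Finset.univ.filter fun e => ε e.1 e.2 h ≠ 0
  let Gw : Fin (n + 1) → Finset (Fin m × Fin m) := fun k =>
    Finset.univ.filter fun e => ε e.1 e.2 w ≠ 0 ∧ e.1 ∉ dom (R k) ∧ e.2 ∉ rng (R k)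
  have hmemGh : ∀ e, e ∈ Gh ↔ ε e.1 e.2 h ≠ 0 := fun e => by simp [Gh]
  have hmemGw : ∀ k e, e ∈ Gw k ↔ ε e.1 e.2 w ≠ 0 ∧ e.1 ∉ dom (R k) ∧ e.2 ∉ rng (R k) := fun k e => by
    simp only [Gw, Finset.mem_filter, Finset.mem_univ, true_and]
  have hpresb : ∀ k b, ε ((p k).1 b) b ((p k).2 b) ≠ 0 := fun k => (termSign_ne_zero_iff ε (p k)).1 (hdom k).1
  have hRG : ∀ k, R k ⊆ Gh := by
    intro k e he
    rw [hmemR] at he; rw [hmemGh, he.1, ← he.2]; exact hpresb k e.2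
  have hdomR : ∀ k a, a ∈ dom (R k) ↔ ∃ b, (p k).1 b = a ∧ (p k).2 b = h := by
    intro k a; rw [mem_dom]
    constructor
    · rintro ⟨b, hb⟩; rw [hmemR] at hb; exact ⟨b, hb.1.symm, hb.2⟩
    · rintro ⟨b, hb1, hb2⟩; exact ⟨b, (hmemR k (a, b)).2 ⟨hb1.symm, hb2⟩⟩
  have hrngR : ∀ k b, b ∈ rng (R k) ↔ (p k).2 b = h := by
    intro k b; rw [mem_rng]
    constructor
    · rintro ⟨a, ha⟩; rw [hmemR] at ha; exact ha.2
    · intro hb; exact ⟨(p k).1 b, (hmemR k _).2 ⟨rfl, hb⟩⟩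
  have hSG : ∀ k, S k ⊆ Gw k := by
    intro k e he
    rw [hmemS] at he
    rw [hmemGw]
    refine ⟨by rw [he.1, ← he.2]; exact hpresb k e.2, fun ha => ?_, fun hb => ?_⟩
    · obtain ⟨b, hb1, hb2⟩ := (hdomR k _).1 ha
      rw [he.1] at hb1
      have hbe : b = e.2 := (p k).1.injective hb1
      rw [hbe, he.2] at hb2
      have : d w < d w := by nth_rewrite 2 [hb2]; exact hwh
      exact lt_irrefl _ this
    · rw [hrngR] at hb
      have hwh' : w = h := he.2.symm.trans hb
      have : d w < d w := by nth_rewrite 2 [hwh']; exact hwh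
      exact lt_irrefl _ this
  -- LEVEL MINIMALITY (from dominance)
  have hminR : ∀ k (X : Finset (Fin m × Fin m)), IsPMatching X → X ⊆ Gh →
      ∑ e ∈ R k, u e.1 e.2 h - θ k * ((R k).card : ℤ) ≤ ∑ e ∈ X, u e.1 e.2 h - θ k * (X.card : ℤ) := by
    intro k X hX hXG
    exact level_min_of_isDominant d v ε u A z h hhz hdz hinj hu huA hvz hdense hsep hsep0 (hwin k) (hdom k) X hX
      (fun e he => (hmemGh e).1 (hXG he)) (fun e _ b hb => absurd hb (hnot_gt_h k b)) (fun e _ => hnot_gt_h k e.2)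
  have hminS : ∀ k (X : Finset (Fin m × Fin m)), IsPMatching X → X ⊆ Gw k →
      ∑ e ∈ S k, u e.1 e.2 w - θ k * ((S k).card : ℤ) ≤ ∑ e ∈ X, u e.1 e.2 w - θ k * (X.card : ℤ) := by
    intro k X hX hXG
    refine level_min_of_isDominant d v ε u A z w hwz hdz hinj hu huA hvz hdense hsep hsep0 (hwin k) (hdom k) X hX
      (fun e he => ((hmemGw k e).1 (hXG he)).1) (fun e he b hb => ?_) (fun e he hlt => ?_)
    · have hcl := hgt_w k b hb
      intro hba
      exact ((hmemGw k e).1 (hXG he)).2.1 ((hdomR k _).2 ⟨b, hba, hcl⟩)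
    · exact ((hmemGw k e).1 (hXG he)).2.2 ((hrngR k _).2 (hgt_w k _ hlt))
  -- ONE STEP OF THE CHAIN
  have hstep : ∀ k : Fin n, 3 * (R k.castSucc).card + (S k.castSucc).card + 1 ≤ 3 * (R k.succ).card + (S k.succ).card := by
    intro k
    have hlt : θ k.castSucc < θ k.succ := hθ Fin.castSucc_lt_succ
    -- top level: count monotone, coverage nested, equal count ⇒ equal
    have hRle : (R k.castSucc).card ≤ (R k.succ).card :=
      card_mono_of_param (u := fun e => u e.1 e.2 h) hlt (hRm _) (hRG _) (hRm _) (hRG _) (hminR _) (hminR _)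
    have hgenGh : ∀ X Y : Finset (Fin m × Fin m), IsPMatching X → IsPMatching Y → X ⊆ Gh → Y ⊆ Gh → X.card = Y.card →
        ∑ e ∈ X, (fun e : Fin m × Fin m => u e.1 e.2 h) e = ∑ e ∈ Y, (fun e : Fin m × Fin m => u e.1 e.2 h) e → X = Y :=
      fun X Y hX hY hXG hYG hc hs => hgenh X Y hX hY (fun e he => (hmemGh e).1 (hXG he)) (fun e he => (hmemGh e).1 (hYG he)) hc hs
    have hnest : dom (R k.castSucc) ⊆ dom (R k.succ) ∧ rng (R k.castSucc) ⊆ rng (R k.succ) :=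
      cover_mono_of_param (u := fun e => u e.1 e.2 h) hlt hgenGh (hRm _) (hRG _) (hRm _) (hRG _) (hminR _) (hminR _)
    have hReq : (R k.castSucc).card = (R k.succ).card → R k.castSucc = R k.succ := by
      intro hc
      have h1 := hminR k.castSucc (R k.succ) (hRm _) (hRG _)
      have h2 := hminR k.succ (R k.castSucc) (hRm _) (hRG _)
      rw [hc] at h1; rw [← hc] at h2
      exact hgenGh _ _ (hRm _) (hRm _) (hRG _) (hRG _) hc (by simp only; linarith)
    -- middle level: the allowed set shrinks by the newly covered rows `Dr` and columns `Dc`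
    set Dr : Finset (Fin m) := dom (R k.succ) \ dom (R k.castSucc) with hDr
    set Dc : Finset (Fin m) := rng (R k.succ) \ rng (R k.castSucc) with hDc
    have hcDr : Dr.card = (R k.succ).card - (R k.castSucc).card := by
      rw [hDr, Finset.card_sdiff_of_subset hnest.1, (hRm _).card_dom, (hRm _).card_dom]
    have hcDc : Dc.card = (R k.succ).card - (R k.castSucc).card := by
      rw [hDc, Finset.card_sdiff_of_subset hnest.2, (hRm _).card_rng, (hRm _).card_rng]
    have hGw1 : Gw k.succ = ((Gw k.castSucc).filter (fun e => e.1 ∉ Dr)).filter (fun e => e.2 ∉ Dc) := by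
      ext e
      simp only [Finset.mem_filter, hmemGw, hDr, hDc, Finset.mem_sdiff, not_and, not_not]
      constructor
      · rintro ⟨h1, h2, h3⟩
        exact ⟨⟨⟨h1, fun ha => h2 (hnest.1 ha), fun hb => h3 (hnest.2 hb)⟩, fun ha => absurd ha h2⟩, fun hb => absurd hb h3⟩
      · rintro ⟨⟨⟨h1, h2, h3⟩, h4⟩, h5⟩
        exact ⟨h1, fun ha => h2 (h4 ha), fun hb => h3 (h5 hb)⟩
    -- the middle optimum after the step, read as a plain minimum-weight matching for the weight `u_w − θ'`
    have hminS1 : ∀ X : Finset (Fin m × Fin m), IsPMatching X →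
        X ⊆ ((Gw k.castSucc).filter (fun e => e.1 ∉ Dr)).filter (fun e => e.2 ∉ Dc) →
        ∑ e ∈ S k.succ, (u e.1 e.2 w - θ k.succ) ≤ ∑ e ∈ X, (u e.1 e.2 w - θ k.succ) := by
      intro X hX hXG
      rw [sum_sub_const, sum_sub_const]
      rw [← hGw1] at hXG
      exact hminS k.succ X hX hXG
    have hS1G : S k.succ ⊆ ((Gw k.castSucc).filter (fun e => e.1 ∉ Dr)).filter (fun e => e.2 ∉ Dc) := hGw1 ▸ hSG k.succ
    -- un-delete the columns, then the rows: a minimiser over `Gw k.castSucc` at `θ'` with few extra edges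
    obtain ⟨M₁, hM₁, hM₁G, hmin₁, hc₁⟩ :=
      exists_isMin_card_le_cols (G := (Gw k.castSucc).filter (fun e => e.1 ∉ Dr)) (w := fun e => u e.1 e.2 w - θ k.succ)
        Dc (S k.succ) (hSm _) hS1G hminS1
    obtain ⟨M, hM, hMG, hmin, hc⟩ :=
      exists_isMin_card_le_rows (G := Gw k.castSucc) (w := fun e => u e.1 e.2 w - θ k.succ) Dr M₁ hM₁ hM₁G hmin₁
    have hminM : ∀ X : Finset (Fin m × Fin m), IsPMatching X → X ⊆ Gw k.castSucc →
        ∑ e ∈ M, u e.1 e.2 w - θ k.succ * (M.card : ℤ) ≤ ∑ e ∈ X, u e.1 e.2 w - θ k.succ * (X.card : ℤ) := by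
      intro X hX hXG
      have := hmin X hX hXG
      rwa [sum_sub_const, sum_sub_const] at this
    -- monotone statics on `Gw k.castSucc`: `|S k| ≤ |M|`
    have hSle : (S k.castSucc).card ≤ M.card :=
      card_mono_of_param (u := fun e => u e.1 e.2 w) hlt (hSm _) (hSG _) hM hMG (hminS _) hminM
    have hSdrop : (S k.castSucc).card ≤ (S k.succ).card + 2 * ((R k.succ).card - (R k.castSucc).card) := by
      rw [hcDr] at hc; rw [hcDc] at hc₁; omega
    -- if the top count does not move: top cells equal, middle count does not drop, and equal middle count ⇒ equal middle cells
    have hsame : (R k.castSucc).card = (R k.succ).card →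
        (S k.castSucc).card ≤ (S k.succ).card ∧ ((S k.castSucc).card = (S k.succ).card → S k.castSucc = S k.succ) := by
      intro hc0
      have hReq' := hReq hc0
      have hGweq : Gw k.succ = Gw k.castSucc := by
        ext e; rw [hmemGw, hmemGw, hReq']
      have h1 : (S k.castSucc).card ≤ (S k.succ).card :=
        card_mono_of_param (u := fun e => u e.1 e.2 w) hlt (hSm _) (hSG _) (hSm _) (hGweq ▸ hSG k.succ) (hminS _)
          (fun X hX hXG => hminS k.succ X hX (hGweq.symm ▸ hXG))
      refine ⟨h1, fun hc => ?_⟩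
      have e1 := hminS k.castSucc (S k.succ) (hSm _) (hGweq ▸ hSG k.succ)
      have e2 := hminS k.succ (S k.castSucc) (hSm _) (hGweq.symm ▸ hSG k.castSucc)
      rw [hc] at e1; rw [← hc] at e2
      exact hgenw _ _ (hSm _) (hSm _) (fun e he => ((hmemGw _ e).1 (hSG _ he)).1) (fun e he => ((hmemGw _ e).1 (hSG _ he)).1) hc
        (by linarith)
    -- both levels unchanged is impossible: the class maps agree, so the two weights differ by a slope-free constant
    have hboth : R k.castSucc = R k.succ → S k.castSucc = S k.succ → False := by
      intro hR hS
      have hcls_eq : (p k.castSucc).2 = (p k.succ).2 := by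
        funext b
        have eh : (p k.castSucc).2 b = h ↔ (p k.succ).2 b = h := by rw [← hrngR, ← hrngR, hR]
        have hrngS : ∀ k' b', b' ∈ rng (S k') ↔ (p k').2 b' = w := by
          intro k' b'; rw [mem_rng]
          constructor
          · rintro ⟨a, ha⟩; rw [hmemS] at ha; exact ha.2
          · intro hb; exact ⟨(p k').1 b', (hmemS k' _).2 ⟨rfl, hb⟩⟩
        have ew : (p k.castSucc).2 b = w ↔ (p k.succ).2 b = w := by rw [← hrngS, ← hrngS, hS]
        rcases hpres k.castSucc b with e | e | e
        · rcases hpres k.succ b with e' | e' | e'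
          · rw [e, e']
          · exact absurd (ew.2 e') (by rw [e]; exact fun h' => hwz h'.symm)
          · exact absurd (eh.2 e') (by rw [e]; exact fun h' => hhz h'.symm)
        · rw [e, ew.1 e]
        · rw [e, eh.1 e]
      have hW : ∀ t : ℤ, tropWeight d v t (p k.castSucc) - tropWeight d v t (p k.succ) =
          ∑ b, v ((p k.succ).1 b) b ((p k.succ).2 b) - ∑ b, v ((p k.castSucc).1 b) b ((p k.castSucc).2 b) := by
        intro t; unfold tropWeight; rw [hcls_eq]; ring
      have h1 := (hdom k.castSucc).2 (p k.succ) (hne k).symm (hdom k.succ).1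
      have h2 := (hdom k.succ).2 (p k.castSucc) (hne k) (hdom k.castSucc).1
      have e1 := hW (θ k.castSucc)
      have e2 := hW (θ k.succ)
      linarith
    -- the potential step
    rcases Nat.eq_or_lt_of_le hRle with hc0 | hc0
    · obtain ⟨hS0, hSeq⟩ := hsame hc0
      rcases Nat.eq_or_lt_of_le hS0 with hs | hs
      · exact (hboth (hReq hc0) (hSeq hs)).elim
      · omega
    · omega
  -- TELESCOPE the potential `3|R| + |S| ≤ 4m`
  have hpot : ∀ i : ℕ, (hi : i ≤ n) → 3 * (R ⟨0, by omega⟩).card + (S ⟨0, by omega⟩).card + i ≤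
      3 * (R ⟨i, by omega⟩).card + (S ⟨i, by omega⟩).card := by
    intro i
    induction i with
    | zero => intro _; simp
    | succ i ih =>
      intro hi
      have h1 := ih (by omega)
      have h2 := hstep ⟨i, by omega⟩
      have e1 : (⟨i, by omega⟩ : Fin n).castSucc = (⟨i, by omega⟩ : Fin (n + 1)) := rfl
      have e2 : (⟨i, by omega⟩ : Fin n).succ = (⟨i + 1, by omega⟩ : Fin (n + 1)) := rfl
      rw [e1, e2] at h2
      omega
  have hfin := hpot n le_rfl
  have hR := card_le_of_isPMatching (hRm ⟨n, by omega⟩)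
  have hS := card_le_of_isPMatching (hSm ⟨n, by omega⟩)
  omega

end SeparatedLex

end Summit.ValiantsHypothesis.ValiantsHypothesis.Theorems.KPlusLogSqLaw
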